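import Mathlib.AlgebraicGeometry.Morphisms.FiniteType
import Literature.AlgebraicGeometry.Morphisms.GenericFlatnessFinite
import Literature.RingTheory.Flat.GenericFreenessProofs
import HarnessLib

/-!
# Generic flatness over an integral Noetherian base (Görtz–Wedhorn I, Thm. 10.84 / Cor. 10.85; EGA IV₂ 6.9.1)

Görtz–Wedhorn, *Algebraic Geometry I*, Cor. 10.85: a morphism `f : X → S` of finite type (and
locally of finite presentation) to an integral scheme `S` is flat over a dense open subset
`U ⊆ S`, i.e. `f|_{f⁻¹(U)} : f⁻¹(U) → U` is flat.  This file proves the case of an integral,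
locally Noetherian base `S` (where "locally of finite presentation" is automatic), following the
printed proof of Thm. 10.84: the question is local on `S`, so one works over a non-empty affine
open `V = Spec A` (`A` a Noetherian domain); `f` being quasi-compact, `f⁻¹(V)` is a finite union
of affine opens `W = Spec B_W` with `B_W` of finite type over `A`; by generic freeness
(Thm. 10.83 — the tree's discharged named fact `Literature.RingTheory.Flat.GortzWedhorn2020_10_83`,
`GortzWedhorn2020_10_83_holds`) each `B_W[1/s_W]` is flat over `A[1/s_W]` for some `s_W ≠ 0`, so
`f` is flat on the chart `W ∩ f⁻¹ D(s_W) → D(s_W)`; the intersection `D(∏ s_W)` of the finitely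
many dense opens `D(s_W)` is a non-empty (hence dense) open over which `f` is flat, flatness
being a stalk-local property.

* §1 `flat_resLE_basicOpen_of_flat_localizedModule`: the affine chart — if `Γ(X, W)[1/s]` is a
  flat `Γ(S, V)[1/s]`-module then `f` restricted to `X.basicOpen (f♯ s) = W ∩ f⁻¹ D(s) → D(s)` is
  flat (the tree's `RingHom.flat_of_isLocalization_away_of_flat_localizedModule` on the sections
  of the two basic opens, which are the localisations `A[1/s]`, `B_W[1/s]`).
* §2 `exists_flat_morphismRestrict_basicOpen` (over a non-empty affine open `V`, some `s ≠ 0` in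
  `Γ(S, V)` with `f ∣_ D(s)` flat), **`exists_nonempty_flat_morphismRestrict`**,
  **`exists_dense_flat_morphismRestrict`** (Cor. 10.85 as printed: a dense open), and
  `exists_isAffineOpen_flat_morphismRestrict` (the open may be taken affine).

## References

* U. Görtz, T. Wedhorn, *Algebraic Geometry I: Schemes*, 2nd ed., Springer Spektrum (2020):
  Section (10.22), Thm. 10.83 (generic freeness), Thm. 10.84 and its proof, Cor. 10.85 (generic
  flatness), p. 274. [GortzWedhorn2020]
* A. Grothendieck, *Éléments de géométrie algébrique* IV₂, Publ. Math. IHÉS 24 (1965),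
  Théorème 6.9.1. [EGAIV2]

## Design notes

* Cell hodgecm-mathlib (D-0151), F-5 (5b)(B1) "generic-flatness brick" feeding the flattening
  stratification (Mumford, *Lectures on curves on an algebraic surface*, Lect. 8).  HC_CM is
  proved only modulo the 7 printed citations until rung 0 closes; this file asserts nothing about
  HC.  No definition, no instance, no named fact; net debt delta 0.
* Mathlib / Literature searches: Mathlib has `Flat`, `HasRingHomProperty @Flat RingHom.Flat`,
  `Flat.of_stalkMap/stalkMap`, `Scheme.Hom.resLEStalkMap`, `morphismRestrictStalkMap`,
  `arrowResLEAppIso`, `Scheme.basicOpen_appLE`, `Opens.IsBasis.exists_finite_of_isCompact`,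
  `Module.freeLocus`, but no generic flatness/freeness over a finitely generated algebra.
  Literature has the ring-level theorem (`GortzWedhorn2020_10_83_holds` with the proved
  corollaries `GortzWedhorn2020_10_83.flat_localizedModule(_base)`), the finite case
  `exists_nonempty_flat_morphismRestrict_of_isFinite`, the chart lemma
  `RingHom.flat_of_isLocalization_away_of_flat_localizedModule`, `exists_isAffineOpen_nonempty`,
  and a universe-`0` affine version `Literature.AlgebraicGeometry.Resolution.exists_flat_preimage_basicOpen`;
  nothing is restated.
* TODO(general form): Cor. 10.85 for an integral base that is not locally Noetherian and `f`
  locally of finite presentation (elimination of Noetherian hypotheses, GW Thms. 10.60/10.69), and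
  the module form Thm. 10.84 for a quasi-coherent `𝒪_X`-module of finite presentation.
-/

universe u

open CategoryTheory AlgebraicGeometry TopologicalSpace Opposite

namespace Literature.AlgebraicGeometry.Morphisms

open Literature.RingTheory.Flat

/-! ### §1 The affine chart -/

section Chart

variable {X S : Scheme.{u}} (f : X ⟶ S) {V : S.Opens} {W : X.Opens}

/-- `X_{f♯ s} ∩ W ⊆ f⁻¹ D(s)`: the basic open of `W` cut out by the pull-back of a section `s`
over `V ⊇ f(W)` lies over `D(s)` (private helper). [folklore] -/
private theorem basicOpen_appLE_le (e : W ≤ f ⁻¹ᵁ V) (s : Γ(S, V)) :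
    X.basicOpen (f.appLE V W e s) ≤ f ⁻¹ᵁ S.basicOpen s := by
  rw [Scheme.basicOpen_appLE]
  exact inf_le_right

/-- `D(t) ⊆ D(s)` when `s ∣ t` (private helper). [folklore] -/
private theorem basicOpen_le_basicOpen_of_dvd {U : S.Opens} {s t : Γ(S, U)} (h : s ∣ t) :
    S.basicOpen t ≤ S.basicOpen s := by
  obtain ⟨c, rfl⟩ := h
  rw [Scheme.basicOpen_mul]
  exact inf_le_left

/-- **The affine chart of generic flatness** (GW, proof of Thm. 10.84, affine case): let
`V = Spec A ⊆ S` and `W = Spec B ⊆ f⁻¹(V)` be affine opens and `s ∈ A`; if the localised module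
`B[1/s]` is flat over `A[1/s]`, then `f` restricted to `W ∩ f⁻¹ D(s) = D_W(f♯ s) → D(s)` is flat
(its map on global sections is `A[1/s] → B[1/s]`).
[cite: GortzWedhorn2020, Thm. 10.84, proof] -/
theorem flat_resLE_basicOpen_of_flat_localizedModule (hV : IsAffineOpen V) (hW : IsAffineOpen W)
    (e : W ≤ f ⁻¹ᵁ V) (s : Γ(S, V))
    (hflat : letI := (f.appLE V W e).hom.toAlgebra
      Module.Flat (Localization.Away s) (LocalizedModule (Submonoid.powers s) Γ(X, W))) :
    Flat (f.resLE (S.basicOpen s) (X.basicOpen (f.appLE V W e s)) (basicOpen_appLE_le f e s)) := by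
  letI alg : Algebra Γ(S, V) Γ(X, W) := (f.appLE V W e).hom.toAlgebra
  have e' : X.basicOpen (f.appLE V W e s) ≤ f ⁻¹ᵁ S.basicOpen s := basicOpen_appLE_le f e s
  haveI : IsLocalization.Away s Γ(S, S.basicOpen s) := hV.isLocalization_basicOpen s
  haveI : IsLocalization.Away (algebraMap Γ(S, V) Γ(X, W) s)
      Γ(X, X.basicOpen (f.appLE V W e s)) :=
    hW.isLocalization_basicOpen (f.appLE V W e s)
  -- the induced map on the two localisations is `f.appLE D(s) D_W(f♯ s)`, compatible with `f♯`
  have h1 := f.map_appLE e' (homOfLE (S.basicOpen_le s)).op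
  have h2 := f.appLE_map e (homOfLE (X.basicOpen_le (f.appLE V W e s))).op
  have hψ' : S.presheaf.map (homOfLE (S.basicOpen_le s)).op ≫
      f.appLE (S.basicOpen s) (X.basicOpen (f.appLE V W e s)) e' =
      f.appLE V W e ≫ X.presheaf.map (homOfLE (X.basicOpen_le (f.appLE V W e s))).op :=
    h1.trans h2.symm
  have hψ : (f.appLE (S.basicOpen s) (X.basicOpen (f.appLE V W e s)) e').hom.comp
      (algebraMap Γ(S, V) Γ(S, S.basicOpen s)) =
      (algebraMap Γ(X, W) Γ(X, X.basicOpen (f.appLE V W e s))).comp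
        (algebraMap Γ(S, V) Γ(X, W)) := by
    have := congrArg CommRingCat.Hom.hom hψ'
    rw [CommRingCat.hom_comp, CommRingCat.hom_comp] at this
    exact this
  have hQ : (f.appLE (S.basicOpen s) (X.basicOpen (f.appLE V W e s)) e').hom.Flat :=
    RingHom.flat_of_isLocalization_away_of_flat_localizedModule s _ hψ hflat
  haveI : IsAffine (S.basicOpen s : S.Opens) := hV.basicOpen s
  haveI : IsAffine (X.basicOpen (f.appLE V W e s) : X.Opens) := hW.basicOpen (f.appLE V W e s)
  refine (HasRingHomProperty.iff_of_isAffine (P := @Flat)).mpr ?_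
  exact (RingHom.Flat.respectsIso.arrow_mk_iso_iff (arrowResLEAppIso f _ _ e')).mpr hQ

end Chart

/-! ### §2 Generic flatness -/

section Global

variable {X S : Scheme.{u}} (f : X ⟶ S) [LocallyOfFiniteType f] [QuasiCompact f] [IsIntegral S]
  [IsLocallyNoetherian S]

/-- **Generic flatness over a non-empty affine open of the base** (GW, proof of Thm. 10.84): for
`f : X → S` of finite type, `S` integral and locally Noetherian, and `V = Spec A ⊆ S` a non-empty
affine open, there is `s ∈ A ∖ {0}` such that `f ∣_ D(s) : f⁻¹ D(s) → D(s)` is flat.  Proof as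
printed: `f⁻¹(V)` is a finite union of affine opens `W = Spec B_W` (`f` quasi-compact), `B_W` of
finite type over the Noetherian domain `A`; generic freeness (Thm. 10.83,
`GortzWedhorn2020_10_83_holds`) gives `s_W ≠ 0` with `B_W[1/s_W]` flat over `A[1/s_W]`; take
`s = ∏ s_W` and check flatness of `f ∣_ D(s)` on stalks, every point of `f⁻¹ D(s)` lying in some
chart `W ∩ f⁻¹ D(s_W)`. [cite: GortzWedhorn2020, Thm. 10.84, proof] -/
theorem exists_flat_morphismRestrict_basicOpen {V : S.Opens} (hV : IsAffineOpen V)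
    (hVne : (V : Set S).Nonempty) :
    ∃ s : Γ(S, V), s ≠ 0 ∧ Flat (f ∣_ S.basicOpen s) := by
  classical
  haveI : Nonempty V := hVne.to_subtype
  haveI : IsNoetherianRing Γ(S, V) := IsLocallyNoetherian.component_noetherian ⟨V, hV⟩
  -- a finite affine open cover of `f⁻¹ V`
  obtain ⟨Us, hUs, hUf, hcov⟩ :=
    X.isBasis_affineOpens.exists_finite_of_isCompact (f.isCompact_preimage hV.isCompact (U := V))
  haveI : Fintype Us := hUf.fintype
  have hle : ∀ W : Us, (W : X.Opens) ≤ f ⁻¹ᵁ V := fun W => hcov ▸ le_sSup W.2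
  -- generic freeness on each chart
  have key : ∀ W : Us, ∃ s : Γ(S, V), s ≠ 0 ∧
      Flat (f.resLE (S.basicOpen s) (X.basicOpen (f.appLE V W (hle W) s))
        (basicOpen_appLE_le f (hle W) s)) := by
    intro W
    have hW : IsAffineOpen (W : X.Opens) := hUs W.2
    letI alg : Algebra Γ(S, V) Γ(X, W) := (f.appLE V W (hle W)).hom.toAlgebra
    have hft : Algebra.FiniteType Γ(S, V) Γ(X, W) := f.finiteType_appLE hV hW (hle W)
    obtain ⟨s, hs0, -, hflat⟩ := GortzWedhorn2020_10_83.flat_localizedModule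
      GortzWedhorn2020_10_83_holds Γ(S, V) Γ(X, W) Γ(X, W) hft inferInstance
    exact ⟨s, hs0, flat_resLE_basicOpen_of_flat_localizedModule f hV hW (hle W) s hflat⟩
  choose s hs0 hsflat using key
  -- `D(∏ s_W)` is the sought open
  refine ⟨∏ W, s W, Finset.prod_ne_zero_iff.mpr fun W _ => hs0 W, Flat.of_stalkMap _ fun x => ?_⟩
  have hdvd : ∀ W : Us, s W ∣ ∏ W, s W := fun W => Finset.dvd_prod_of_mem _ (Finset.mem_univ W)
  have hxU : f x.1 ∈ S.basicOpen (∏ W, s W) := x.2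
  have hxV : x.1 ∈ f ⁻¹ᵁ V := S.basicOpen_le _ hxU
  rw [hcov] at hxV
  obtain ⟨W, hWUs, hxW⟩ := Opens.mem_sSup.mp hxV
  have hxW' : x.1 ∈ X.basicOpen (f.appLE V W (hle ⟨W, hWUs⟩) (s ⟨W, hWUs⟩)) := by
    rw [Scheme.basicOpen_appLE]
    exact ⟨hxW, basicOpen_le_basicOpen_of_dvd (hdvd ⟨W, hWUs⟩) hxU⟩
  haveI := hsflat ⟨W, hWUs⟩
  have h1 := Flat.stalkMap (f.resLE (S.basicOpen (s ⟨W, hWUs⟩))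
    (X.basicOpen (f.appLE V W (hle ⟨W, hWUs⟩) (s ⟨W, hWUs⟩)))
    (basicOpen_appLE_le f (hle ⟨W, hWUs⟩) (s ⟨W, hWUs⟩))) ⟨x.1, hxW'⟩
  have h2 : (f.stalkMap x.1).hom.Flat :=
    (RingHom.Flat.respectsIso.arrow_mk_iso_iff (f.resLEStalkMap _ ⟨x.1, hxW'⟩)).mp h1
  exact (RingHom.Flat.respectsIso.arrow_mk_iso_iff (morphismRestrictStalkMap f _ x)).mpr h2

/-- **Generic flatness, affine form** (GW Cor. 10.85 / EGA IV₂ 6.9.1, Noetherian base): for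
`f : X → S` of finite type with `S` integral and locally Noetherian there is a non-empty *affine*
open `U ⊆ S` over which `f` is flat. [cite: GortzWedhorn2020, Cor. 10.85] -/
theorem exists_isAffineOpen_flat_morphismRestrict :
    ∃ U : S.Opens, IsAffineOpen U ∧ (U : Set S).Nonempty ∧ Flat (f ∣_ U) := by
  obtain ⟨V, hV, hVne⟩ := exists_isAffineOpen_nonempty S
  obtain ⟨s, hs0, hflat⟩ := exists_flat_morphismRestrict_basicOpen f hV hVne
  refine ⟨S.basicOpen s, hV.basicOpen s, ?_, hflat⟩
  rw [Set.nonempty_iff_ne_empty, Ne, ← TopologicalSpace.Opens.coe_bot, SetLike.coe_set_eq,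
    basicOpen_eq_bot_iff]
  exact hs0

/-- **Generic flatness** (GW Cor. 10.85 / EGA IV₂ 6.9.1, Noetherian base): a morphism
`f : X → S` of finite type to an integral, locally Noetherian scheme `S` is flat over some
non-empty open `U ⊆ S`: `f ∣_ U : f⁻¹(U) → U` is flat. [cite: GortzWedhorn2020, Cor. 10.85] -/
theorem exists_nonempty_flat_morphismRestrict :
    ∃ U : S.Opens, (U : Set S).Nonempty ∧ Flat (f ∣_ U) := by
  obtain ⟨U, -, hUne, hflat⟩ := exists_isAffineOpen_flat_morphismRestrict f
  exact ⟨U, hUne, hflat⟩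

/-- **Generic flatness, as printed** (GW Cor. 10.85 / EGA IV₂ 6.9.1, Noetherian base): a
morphism `f : X → S` of finite type to an integral, locally Noetherian scheme `S` is flat over a
*dense* open subset `U ⊆ S` (a non-empty open subset of the irreducible space `S` is dense).
[cite: GortzWedhorn2020, Cor. 10.85] -/
theorem exists_dense_flat_morphismRestrict :
    ∃ U : S.Opens, Dense (U : Set S) ∧ Flat (f ∣_ U) := by
  obtain ⟨U, hUne, hflat⟩ := exists_nonempty_flat_morphismRestrict f
  exact ⟨U, U.isOpen.dense hUne, hflat⟩

end Global

end Literature.AlgebraicGeometry.Morphisms
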